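import Literature.Geometry.Lorentzian.AsymptoticallyFlatChart
import Literature.Geometry.Lorentzian.AFEndPatch
import Literature.Geometry.Lorentzian.AFEndChartEmbedding
import HarnessLib

/-!
# Transplanting an asymptotically flat end of `ℝ³`, rescaled, into the end of a `3`-manifold

Plumbing for gluing constructions (topic `Geometry/Lorentzian`; the construction is explicit and
everything about it is PROVED). Let `e : AFEnd X` be an end of the `3`-manifold `X` and
`f : AFEnd E3` an end of `ℝ³` (e.g. the asymptotically flat end of a body that is to be inserted,
rescaled by a factor `λ > 0`, far out in the end `e`). Write `coord = e.coord : X → ℝ³` for the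
total coordinate function of `e` and `Ψ x = λ⁻¹ • coord x` for the **transplant map** (so that the
point `y` of the body corresponds to the point of `X` with coordinate `λ y`). If the far region
`f.far ρ₁` (`ρ₁ ≥ f.R`) of the body lies in `{ρ₀ ≤ ‖y‖}` with `λ ρ₀ > e.R` (`TransplantData`), then

* `AFEnd.transplant` — **the transplanted end** of `X`: open set `{x ∈ e.U | Ψ x ∈ f.far ρ₁}`,
  radius `λ ρ₁`, chart `x ↦ λ • f.coord (Ψ x)` with inverse `ζ ↦ Φₑ (λ • Φ_f (λ⁻¹ • ζ))`
  (`Φ = dataChartExt`); it is closed at infinity because its closed far sets are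
  `coord⁻¹`-preimages, inside the closed far set `{λ ρ₀ ≤ ‖coord‖}` of `e`, of the (rescaled)
  closed far sets of `f`;
* `transplant_dataChartExt`, `coord_transplant`, `mem_transplant_U_iff`, `transplant_far` — its
  inverse chart, coordinate function and far regions in terms of those of `e` and `f`;
* `isSoleEnd_transplant` — if `e` is the sole end of `X` and `f` the sole end of `ℝ³`, the
  transplanted end is the sole end of `X` (its far regions contain far regions of `e`).

The chart components of data along the transplanted end are computed in the sequel
(`AFEndTransplantCoeff.lean`). This is the structure-at-infinity bookkeeping of "insert a rescaled
asymptotically flat body at the end" (Bartnik 1986, §1, structures of infinity; used implicitly in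
every far-field gluing, e.g. Corvino–Schoen 2006, Hintz 2022).

## References

* R. Bartnik, *The mass of an asymptotically flat manifold*, CPAM 39 (1986), §1. [Bartnik1986]
-/

noncomputable section

open Bundle Set Filter TopologicalSpace Metric
open scoped Manifold ContDiff Topology

namespace Literature.Geometry.Lorentzian

namespace AFEnd


/-! ### The transplanted end -/

variable {X : Type} [TopologicalSpace X] [ChartedSpace E3 X] (e : AFEnd X) (f : AFEnd E3)
  {lam ρ₀ ρ₁ : ℝ}

/-- **The hypotheses of the transplant**: a scale `λ > 0`, the far region `f.far ρ₁` (`ρ₁ ≥ f.R`)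
of the body lies in `{ρ₀ ≤ ‖y‖}`, and `λ ρ₀ > e.R` (so that the rescaled region lies in the end of
`X`, with room to spare). [cite: Bartnik1986, §1] -/
structure TransplantData (e : AFEnd X) (f : AFEnd E3) (lam ρ₀ ρ₁ : ℝ) : Prop where
  lam_pos : 0 < lam
  R_le : f.R ≤ ρ₁
  lt_mul : e.R < lam * ρ₀
  le_norm : ∀ y ∈ f.far ρ₁, ρ₀ ≤ ‖y‖

variable {e f}

namespace TransplantData

variable (T : TransplantData e f lam ρ₀ ρ₁)
include T

/-- `λ ≠ 0`. [folklore] -/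
theorem lam_ne : lam ≠ 0 := T.lam_pos.ne'

/-- A point of the body's far region, rescaled by `λ`, lies in the exterior region of `e`.
[cite: Bartnik1986, §1] -/
theorem lt_norm_smul {y : E3} (hy : y ∈ f.far ρ₁) : e.R < ‖lam • y‖ := by
  rw [norm_smul, Real.norm_of_nonneg T.lam_pos.le]
  exact lt_of_lt_of_le T.lt_mul (mul_le_mul_of_nonneg_left (T.le_norm y hy) T.lam_pos.le)

/-- `‖λ⁻¹ ζ‖ > ρ₁` for `‖ζ‖ > λ ρ₁`. [folklore] -/
theorem lt_norm_inv_smul {ζ : E3} (hζ : lam * ρ₁ < ‖ζ‖) : ρ₁ < ‖lam⁻¹ • ζ‖ := by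
  rw [norm_smul, norm_inv, Real.norm_of_nonneg T.lam_pos.le]
  rw [← div_eq_inv_mul, lt_div_iff₀ T.lam_pos]
  linarith

/-- `‖λ⁻¹ ζ‖ > f.R` for `‖ζ‖ > λ ρ₁`. [folklore] -/
theorem R_lt_norm_inv_smul {ζ : E3} (hζ : lam * ρ₁ < ‖ζ‖) : f.R < ‖lam⁻¹ • ζ‖ :=
  lt_of_le_of_lt T.R_le (T.lt_norm_inv_smul hζ)

end TransplantData

/-- The **transplant map** `Ψ x = λ⁻¹ • coord x` (total; meaningful on the end). [cite: Bartnik1986, §1] -/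
def transplantMap (e : AFEnd X) (lam : ℝ) (x : X) : E3 := lam⁻¹ • e.coord x

/-- `Ψ x = λ⁻¹ • coord x`. [folklore] -/
theorem transplantMap_apply (lam : ℝ) (x : X) : e.transplantMap lam x = lam⁻¹ • e.coord x := rfl

/-- `λ • Ψ x = coord x` (`λ ≠ 0`). [folklore] -/
theorem smul_transplantMap {lam : ℝ} (hlam : lam ≠ 0) (x : X) :
    lam • e.transplantMap lam x = e.coord x := by
  rw [transplantMap_apply, smul_inv_smul₀ hlam]

/-- `Ψ (Φₑ ζ) = λ⁻¹ • ζ` for `‖ζ‖ > e.R`. [folklore] -/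
theorem transplantMap_dataChartExt {lam : ℝ} {ζ : E3} (hζ : e.R < ‖ζ‖) :
    e.transplantMap lam (e.dataChartExt ζ) = lam⁻¹ • ζ := by
  rw [transplantMap_apply, e.coord_dataChartExt_of_lt hζ]

/-- `Ψ` is smooth on the end (scalar multiple of `coord`). [folklore] -/
theorem contMDiffAt_transplantMap (lam : ℝ) {x : X} (hx : x ∈ e.U) :
    ContMDiffAt (𝓡 3) 𝓘(ℝ, E3) ∞ (e.transplantMap lam) x :=
  (contMDiffAt_const : ContMDiffAt (𝓡 3) 𝓘(ℝ, ℝ) ∞ (fun _ : X ↦ lam⁻¹) x).smul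
    (e.contMDiffAt_coord hx)

/-- `Ψ` is continuous on the end. [folklore] -/
theorem continuousOn_transplantMap (lam : ℝ) : ContinuousOn (e.transplantMap lam) e.U :=
  fun _ hx ↦ (e.contMDiffAt_transplantMap lam hx).continuousAt.continuousWithinAt

variable (T : TransplantData e f lam ρ₀ ρ₁)

/-- The carrier `{x ∈ e.U | Ψ x ∈ f.far ρ₁}` of the transplanted end is open. [cite: Bartnik1986, §1] -/
theorem isOpen_transplantCarrier (e : AFEnd X) (f : AFEnd E3) (lam ρ₁ : ℝ) :
    IsOpen {x : X | x ∈ e.U ∧ e.transplantMap lam x ∈ f.far ρ₁} :=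
  (e.continuousOn_transplantMap lam).isOpen_inter_preimage e.U.isOpen (f.isOpen_far ρ₁)

/-- The open set of the transplanted end. [cite: Bartnik1986, §1] -/
def transplantOpens (e : AFEnd X) (f : AFEnd E3) (lam ρ₁ : ℝ) : Opens X :=
  ⟨{x : X | x ∈ e.U ∧ e.transplantMap lam x ∈ f.far ρ₁}, isOpen_transplantCarrier e f lam ρ₁⟩

/-- Membership in the open set of the transplanted end. [folklore] -/
theorem mem_transplantOpens {lam ρ₁ : ℝ} {x : X} :
    x ∈ transplantOpens e f lam ρ₁ ↔ x ∈ e.U ∧ e.transplantMap lam x ∈ f.far ρ₁ := Iff.rfl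

include T in
/-- The chart value `λ • f.coord (Ψ x)` has norm `> λ ρ₁` on the carrier. [folklore] -/
theorem lt_norm_transplantChart {x : X} (hx : x ∈ transplantOpens e f lam ρ₁) :
    lam * ρ₁ < ‖lam • f.coord (e.transplantMap lam x)‖ := by
  obtain ⟨_, hfar⟩ := (mem_transplantOpens).1 hx
  obtain ⟨_, hlt⟩ := f.mem_far_iff_coord.1 hfar
  rw [norm_smul, Real.norm_of_nonneg T.lam_pos.le]
  exact mul_lt_mul_of_pos_left hlt T.lam_pos

include T in
/-- The inverse chart value `Φₑ (λ • Φ_f (λ⁻¹ • ζ))` lies on the carrier for `‖ζ‖ > λ ρ₁`, with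
`Ψ`-image `Φ_f (λ⁻¹ • ζ)`. [folklore] -/
theorem transplantInv_mem {ζ : E3} (hζ : lam * ρ₁ < ‖ζ‖) :
    e.dataChartExt (lam • f.dataChartExt (lam⁻¹ • ζ)) ∈ transplantOpens e f lam ρ₁ ∧
      e.transplantMap lam (e.dataChartExt (lam • f.dataChartExt (lam⁻¹ • ζ))) =
        f.dataChartExt (lam⁻¹ • ζ) := by
  have h1 : f.R < ‖lam⁻¹ • ζ‖ := T.R_lt_norm_inv_smul hζ
  have hfar : f.dataChartExt (lam⁻¹ • ζ) ∈ f.far ρ₁ :=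
    (f.dataChartExt_mem_far_iff h1).2 (T.lt_norm_inv_smul hζ)
  have h2 : e.R < ‖lam • f.dataChartExt (lam⁻¹ • ζ)‖ := T.lt_norm_smul hfar
  have hΨ : e.transplantMap lam (e.dataChartExt (lam • f.dataChartExt (lam⁻¹ • ζ))) =
      f.dataChartExt (lam⁻¹ • ζ) := by
    rw [e.transplantMap_dataChartExt h2, inv_smul_smul₀ T.lam_ne]
  refine ⟨(mem_transplantOpens).2 ⟨e.dataChartExt_mem h2, ?_⟩, hΨ⟩
  rw [hΨ]
  exact hfar

include T in
/-- The forward chart `x ↦ λ • f.coord (Ψ x)` of the transplanted end is smooth. [folklore] -/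
theorem contMDiff_transplantChart_toFun :
    ContMDiff (𝓡 3) (𝓡 3) ∞ (fun x : transplantOpens e f lam ρ₁ ↦
      (⟨lam • f.coord (e.transplantMap lam x), lt_norm_transplantChart T x.2⟩ :
        exteriorRegion (lam * ρ₁))) := by
  rw [← ContMDiff.subtypeVal_comp_iff]
  intro x
  obtain ⟨hxU, hfar⟩ := (mem_transplantOpens).1 x.2
  have hΨ := e.contMDiffAt_transplantMap lam hxU
  have hf : ContMDiffAt 𝓘(ℝ, E3) 𝓘(ℝ, E3) ∞ f.coord (e.transplantMap lam x) :=
    f.contMDiffAt_coord (f.far_subset ρ₁ hfar)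
  have h : ContMDiffAt (𝓡 3) 𝓘(ℝ, E3) ∞ (fun y : X ↦ lam • f.coord (e.transplantMap lam y)) x :=
    (contMDiffAt_const : ContMDiffAt (𝓡 3) 𝓘(ℝ, ℝ) ∞ (fun _ : X ↦ lam) x).smul
      (hf.comp (x : X) hΨ)
  exact (contMDiffAt_subtype_iff (U := transplantOpens e f lam ρ₁)
    (f := fun y : X ↦ lam • f.coord (e.transplantMap lam y))).2 h

include T in
/-- The backward chart `ζ ↦ Φₑ (λ • Φ_f (λ⁻¹ • ζ))` of the transplanted end is smooth. [folklore] -/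
theorem contMDiff_transplantChart_invFun :
    ContMDiff (𝓡 3) (𝓡 3) ∞ (fun ζ : exteriorRegion (lam * ρ₁) ↦
      (⟨e.dataChartExt (lam • f.dataChartExt (lam⁻¹ • (ζ : E3))), (transplantInv_mem T ζ.2).1⟩ :
        transplantOpens e f lam ρ₁)) := by
  rw [← ContMDiff.subtypeVal_comp_iff]
  intro ζ
  have h1 : f.R < ‖lam⁻¹ • (ζ : E3)‖ := T.R_lt_norm_inv_smul ζ.2
  have hfar : f.dataChartExt (lam⁻¹ • (ζ : E3)) ∈ f.far ρ₁ :=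
    (f.dataChartExt_mem_far_iff h1).2 (T.lt_norm_inv_smul ζ.2)
  have h2 : e.R < ‖lam • f.dataChartExt (lam⁻¹ • (ζ : E3))‖ := T.lt_norm_smul hfar
  have hsc : ContMDiffAt 𝓘(ℝ, E3) 𝓘(ℝ, E3) ∞ (fun z : E3 ↦ lam⁻¹ • z) ζ :=
    (contMDiffAt_const : ContMDiffAt 𝓘(ℝ, E3) 𝓘(ℝ, ℝ) ∞ (fun _ : E3 ↦ lam⁻¹) (ζ : E3)).smul
      contMDiffAt_id
  have hA : ContMDiffAt 𝓘(ℝ, E3) 𝓘(ℝ, E3) ∞ (fun z : E3 ↦ lam • f.dataChartExt (lam⁻¹ • z)) ζ :=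
    (contMDiffAt_const : ContMDiffAt 𝓘(ℝ, E3) 𝓘(ℝ, ℝ) ∞ (fun _ : E3 ↦ lam) (ζ : E3)).smul
      ((f.contMDiffAt_dataChartExt h1).comp (ζ : E3) hsc)
  have h : ContMDiffAt 𝓘(ℝ, E3) (𝓡 3) ∞
      (fun z : E3 ↦ e.dataChartExt (lam • f.dataChartExt (lam⁻¹ • z))) ζ :=
    (e.contMDiffAt_dataChartExt h2).comp (ζ : E3) hA
  exact (contMDiffAt_subtype_iff (U := exteriorRegion (lam * ρ₁))
    (f := fun z : E3 ↦ e.dataChartExt (lam • f.dataChartExt (lam⁻¹ • z)))).2 h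

/-- **The chart of the transplanted end**: `x ↦ λ • f.coord (Ψ x)` with inverse
`ζ ↦ Φₑ (λ • Φ_f (λ⁻¹ • ζ))`. [cite: Bartnik1986, §1] -/
def transplantChart (T : TransplantData e f lam ρ₀ ρ₁) :
    Diffeomorph (𝓡 3) (𝓡 3) (transplantOpens e f lam ρ₁) (exteriorRegion (lam * ρ₁)) ∞ where
  toFun x := ⟨lam • f.coord (e.transplantMap lam x), lt_norm_transplantChart T x.2⟩
  invFun ζ := ⟨e.dataChartExt (lam • f.dataChartExt (lam⁻¹ • (ζ : E3))), (transplantInv_mem T ζ.2).1⟩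
  left_inv x := by
    obtain ⟨hxU, hfar⟩ := (mem_transplantOpens).1 x.2
    apply Subtype.ext
    show e.dataChartExt (lam • f.dataChartExt (lam⁻¹ • (lam • f.coord (e.transplantMap lam x)))) = x
    rw [inv_smul_smul₀ T.lam_ne, f.dataChartExt_coord_of_mem (f.far_subset ρ₁ hfar),
      e.smul_transplantMap T.lam_ne, e.dataChartExt_coord_of_mem hxU]
  right_inv ζ := by
    apply Subtype.ext
    show lam • f.coord (e.transplantMap lam (e.dataChartExt (lam • f.dataChartExt (lam⁻¹ • (ζ : E3))))) = ζ
    rw [(transplantInv_mem T ζ.2).2, f.coord_dataChartExt_of_lt (T.R_lt_norm_inv_smul ζ.2),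
      smul_inv_smul₀ T.lam_ne]
  contMDiff_toFun := contMDiff_transplantChart_toFun T
  contMDiff_invFun := contMDiff_transplantChart_invFun T

/-- The chart of the transplanted end is `λ • f.coord ∘ Ψ`. [folklore] -/
@[simp] theorem coe_transplantChart (x : transplantOpens e f lam ρ₁) :
    ((transplantChart T x : exteriorRegion (lam * ρ₁)) : E3) = lam • f.coord (e.transplantMap lam x) :=
  rfl

/-- The inverse chart of the transplanted end. [folklore] -/
@[simp] theorem coe_transplantChart_symm (ζ : exteriorRegion (lam * ρ₁)) :
    (((transplantChart T).symm ζ : transplantOpens e f lam ρ₁) : X) =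
      e.dataChartExt (lam • f.dataChartExt (lam⁻¹ • (ζ : E3))) :=
  rfl

include T in
/-- **The closed far sets of the transplanted end are closed in `X`**: the set
`{x ∈ e.U | Ψ x ∈ f.U, R'' ≤ ‖λ f.coord (Ψ x)‖}` (`R'' > λ ρ₁`) is the intersection of the closed far
set `e.closedFar (λ ρ₀) = {λ ρ₀ ≤ ‖coord‖}` of `e` (closed, `AFEnd.isClosed_closedFar`; inside `e.U`, where `Ψ` is continuous) with the
`Ψ`-preimage of the closed far set `{R''/λ ≤ ‖f.coord‖}` of `f` (closed in `ℝ³`).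
[cite: Bartnik1986, §1] -/
theorem isClosed_transplantFar {R'' : ℝ} (hR'' : lam * ρ₁ < R'') :
    IsClosed {x : X | ∃ _ : x ∈ transplantOpens e f lam ρ₁,
      R'' ≤ ‖lam • f.coord (e.transplantMap lam x)‖} := by
  -- the two closed sets
  set A : Set X := {q : X | ∃ _ : q ∈ e.U, lam * ρ₀ ≤ ‖e.coord q‖} with hA
  have hAcl : IsClosed A := e.isClosed_closedFar T.lt_mul
  have hAU : A ⊆ (e.U : Set X) := fun q ⟨hq, _⟩ ↦ hq
  set B : Set E3 := {y : E3 | ∃ _ : y ∈ f.U, R'' / lam ≤ ‖f.coord y‖} with hB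
  have hRlam : ρ₁ < R'' / lam := by
    rw [lt_div_iff₀ T.lam_pos]; linarith
  have hBcl : IsClosed B := f.isClosed_closedFar (lt_of_le_of_lt T.R_le hRlam)
  have hcont : ContinuousOn (e.transplantMap lam) A := (e.continuousOn_transplantMap lam).mono hAU
  have hcl : IsClosed (A ∩ e.transplantMap lam ⁻¹' B) := hcont.preimage_isClosed_of_isClosed hAcl hBcl
  -- identification of the set
  have heq : {x : X | ∃ _ : x ∈ transplantOpens e f lam ρ₁,
      R'' ≤ ‖lam • f.coord (e.transplantMap lam x)‖} = A ∩ e.transplantMap lam ⁻¹' B := by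
    ext x
    constructor
    · rintro ⟨hx, hR⟩
      obtain ⟨hxU, hfar⟩ := (mem_transplantOpens).1 hx
      have hle : R'' / lam ≤ ‖f.coord (e.transplantMap lam x)‖ := by
        rw [norm_smul, Real.norm_of_nonneg T.lam_pos.le] at hR
        rwa [div_le_iff₀' T.lam_pos]
      refine ⟨⟨hxU, ?_⟩, f.far_subset ρ₁ hfar, hle⟩
      have hρ : ρ₀ ≤ ‖e.transplantMap lam x‖ := T.le_norm _ hfar
      rw [transplantMap_apply, norm_smul, norm_inv, Real.norm_of_nonneg T.lam_pos.le] at hρ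
      rw [le_inv_mul_iff₀ T.lam_pos] at hρ
      exact hρ
    · rintro ⟨⟨hxU, -⟩, hyU, hle⟩
      have hlt : ρ₁ < ‖f.coord (e.transplantMap lam x)‖ := lt_of_lt_of_le hRlam hle
      have hfar : e.transplantMap lam x ∈ f.far ρ₁ := f.mem_far_iff_coord.2 ⟨hyU, hlt⟩
      refine ⟨(mem_transplantOpens).2 ⟨hxU, hfar⟩, ?_⟩
      rw [norm_smul, Real.norm_of_nonneg T.lam_pos.le]
      rwa [div_le_iff₀' T.lam_pos] at hle
  rw [heq]
  exact hcl

/-- **The transplanted end** of `X`: the far region `f.far ρ₁` of the body `ℝ³`, rescaled by `λ`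
and read in the end `e` through `coord`; radius `λ ρ₁`, chart `x ↦ λ • f.coord (λ⁻¹ • coord x)`.
Bartnik 1986, §1 (structures of infinity). [cite: Bartnik1986, §1] -/
def transplant (T : TransplantData e f lam ρ₀ ρ₁) : AFEnd X where
  U := transplantOpens e f lam ρ₁
  R := lam * ρ₁
  R_pos := mul_pos T.lam_pos (f.R_pos.trans_le T.R_le)
  chart := transplantChart T
  isClosed_far R'' hR'' := by
    have heq : ((↑) : transplantOpens e f lam ρ₁ → X) ''
        (transplantChart T ⁻¹' {x | R'' ≤ ‖(x : E3)‖}) =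
        {x : X | ∃ _ : x ∈ transplantOpens e f lam ρ₁,
          R'' ≤ ‖lam • f.coord (e.transplantMap lam x)‖} := by
      ext x
      constructor
      · rintro ⟨x', hx', rfl⟩
        exact ⟨x'.2, hx'⟩
      · rintro ⟨hx, hR⟩
        exact ⟨⟨x, hx⟩, hR, rfl⟩
    rw [heq]
    exact isClosed_transplantFar T hR''

/-- The radius of the transplanted end is `λ ρ₁`. [folklore] -/
@[simp] theorem transplant_R : (transplant T).R = lam * ρ₁ := rfl

/-- The open set of the transplanted end. [folklore] -/
theorem mem_transplant_U {x : X} :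
    x ∈ (transplant T).U ↔ x ∈ e.U ∧ e.transplantMap lam x ∈ f.far ρ₁ := Iff.rfl

/-- **The coordinate function of the transplanted end** is `λ • f.coord ∘ Ψ` on its open set.
[cite: Bartnik1986, §1] -/
theorem coord_transplant {x : X} (hx : x ∈ (transplant T).U) :
    (transplant T).coord x = lam • f.coord (e.transplantMap lam x) := by
  rw [(transplant T).coord_of_mem hx]
  rfl

/-- **The total inverse chart of the transplanted end** is `ζ ↦ Φₑ (λ • Φ_f (λ⁻¹ • ζ))` beyond
radius `λ ρ₁`. [cite: Bartnik1986, §1] -/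
theorem transplant_dataChartExt {ζ : E3} (hζ : lam * ρ₁ < ‖ζ‖) :
    (transplant T).dataChartExt ζ = e.dataChartExt (lam • f.dataChartExt (lam⁻¹ • ζ)) := by
  rw [(transplant T).dataChartExt_of_lt hζ]
  rfl

/-- The inverse chart of the transplanted end on the subtype. [folklore] -/
theorem transplant_dataChart (ζ : exteriorRegion (lam * ρ₁)) :
    (transplant T).dataChart ζ = e.dataChartExt (lam • f.dataChartExt (lam⁻¹ • (ζ : E3))) := rfl

/-- **The far regions of the transplanted end**: `x ∈ far R''` iff `x ∈ e.U` and
`Ψ x ∈ f.far (max ρ₁ (R''/λ))`. [cite: Bartnik1986, §1] -/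
theorem mem_transplant_far_iff {R'' : ℝ} {x : X} :
    x ∈ (transplant T).far R'' ↔ x ∈ e.U ∧ e.transplantMap lam x ∈ f.far (max ρ₁ (R'' / lam)) := by
  rw [(transplant T).mem_far_iff_coord]
  constructor
  · rintro ⟨hx, hlt⟩
    obtain ⟨hxU, hfar⟩ := (mem_transplant_U T).1 hx
    rw [coord_transplant T hx, norm_smul, Real.norm_of_nonneg T.lam_pos.le] at hlt
    obtain ⟨hyU, hρ₁⟩ := f.mem_far_iff_coord.1 hfar
    refine ⟨hxU, f.mem_far_iff_coord.2 ⟨hyU, max_lt hρ₁ ?_⟩⟩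
    rwa [div_lt_iff₀' T.lam_pos]
  · rintro ⟨hxU, hfar⟩
    obtain ⟨hyU, hlt⟩ := f.mem_far_iff_coord.1 hfar
    have hx : x ∈ (transplant T).U :=
      (mem_transplant_U T).2 ⟨hxU, f.mem_far_iff_coord.2 ⟨hyU, (le_max_left _ _).trans_lt hlt⟩⟩
    refine ⟨hx, ?_⟩
    rw [coord_transplant T hx, norm_smul, Real.norm_of_nonneg T.lam_pos.le]
    have h2 : R'' / lam < ‖f.coord (e.transplantMap lam x)‖ := (le_max_right _ _).trans_lt hlt
    rwa [div_lt_iff₀' T.lam_pos] at h2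

/-- Points of `X` with large `e`-coordinate whose `Ψ`-image lies in a far region of `f` lie in the
corresponding far region of the transplanted end (the form used to show soleness). [cite: Bartnik1986, §1] -/
theorem mem_transplant_far {R'' : ℝ} {x : X} (hxU : x ∈ e.U)
    (hfar : e.transplantMap lam x ∈ f.far (max ρ₁ (R'' / lam))) : x ∈ (transplant T).far R'' :=
  (mem_transplant_far_iff T).2 ⟨hxU, hfar⟩

/-- **The transplanted end is the sole end of `X`** when `e` is the sole end of `X` and the far
regions of `f` have bounded complement in `ℝ³` (e.g. `f` is the sole end of `ℝ³`): the complement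
of `(transplant T).far R''` lies in the (compact) complement of a far region of `e`.
[cite: SchoenYau1979] -/
theorem isSoleEnd_transplant (he : e.IsSoleEnd)
    (hf : ∀ R'' : ℝ, ∃ r : ℝ, ∀ y : E3, r < ‖y‖ → y ∈ f.far R'') : (transplant T).IsSoleEnd := by
  -- any radius beyond `λ ρ₁` will do
  refine ⟨lam * ρ₁ + 1, by simp, ?_⟩
  obtain ⟨r, hr⟩ := hf (max ρ₁ ((lam * ρ₁ + 1) / lam))
  -- the complement lies in the complement of `e.far (max e.R (λ (max r 0 + 1)))`... use `λ r'`
  set r' : ℝ := max r 0 + 1 with hr'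
  have hr'pos : 0 < r' := by have := le_max_right r 0; linarith
  obtain ⟨K, hK, hsub⟩ := exists_isCompact_compl_far_subset he (lam * r')
  refine hK.of_isClosed_subset ((transplant T).isOpen_far _).isClosed_compl fun x hx ↦ hsub ?_
  -- if `x ∈ e.far (λ r')` then `Ψ x` has norm `> r' > r`, so `x` is in the transplanted far region
  intro hxfar
  apply hx
  obtain ⟨hxU, hlt⟩ := e.mem_far_iff_coord.1 hxfar
  refine mem_transplant_far T hxU (hr _ ?_)
  rw [transplantMap_apply, norm_smul, norm_inv, Real.norm_of_nonneg T.lam_pos.le,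
    ← div_eq_inv_mul, lt_div_iff₀ T.lam_pos]
  have h1 : r < r' := by have := le_max_left r 0; linarith
  calc r * lam < r' * lam := mul_lt_mul_of_pos_right h1 T.lam_pos
    _ = lam * r' := mul_comm _ _
    _ < ‖e.coord x‖ := hlt

/-- For a SOLE end `f` of `ℝ³`, every far region of `f` contains the exterior of some ball (the
complement of `f.far R''` is compact, hence bounded) — the hypothesis `hf` of
`isSoleEnd_transplant`. [cite: SchoenYau1979] -/
theorem exists_forall_mem_far_of_isSoleEnd (hf : f.IsSoleEnd) (R'' : ℝ) :
    ∃ r : ℝ, ∀ y : E3, r < ‖y‖ → y ∈ f.far R'' := by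
  obtain ⟨K, hK, hsub⟩ := exists_isCompact_compl_far_subset hf R''
  obtain ⟨r, hr⟩ := hK.isBounded.subset_closedBall 0 |>.imp fun r h ↦ h
  refine ⟨r, fun y hy ↦ ?_⟩
  by_contra hyf
  have hyK : y ∈ K := hsub hyf
  have := hr hyK
  rw [mem_closedBall, dist_zero_right] at this
  linarith

end AFEnd

end Literature.Geometry.Lorentzian

end
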